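import Literature.NumberTheory.EllipticCurves.BigGaloisRepSelmer
import Literature.NumberTheory.EllipticCurves.PrimaryTorsionGaloisRep
import Literature.NumberTheory.EllipticCurves.Castella2018.AnticyclotomicSelmerDual
import Literature.NumberTheory.EllipticCurves.HeegnerPoints
import Literature.NumberTheory.EllipticCurves.IwasawaSelmerIsTorsionProofs
import HarnessLib

/-!
# Skinner–Urban 2014, Prop. 3.2.3 (Shapiro's lemma for Selmer groups over `ℤ_p`-extensions), in the
# anticyclotomic BDP/Greenberg setting of Castella 2018, Def. 2.2:
# `X^Σ_ac(E[p^∞]) = Sel^Σ_𝔭(K_∞, E[p^∞])^∨ ≅ Sel^Σ_𝔭(K, T_pE ⊗ Λ^*(Ψ⁻¹))^∨` as `Λ`-modules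

Cell `bsd-stepL` (crux `stmt-BirchSwinnertonDyer-19270`, Road FF, fact F1 of
SPEC-19270-RoadFF-objects-imc-p1-g6.md). ONE named fact (a published proposition, with proof in the
source) stated on the tree's objects, plus PROVED corollaries in the shape the kernel glue
`Summit.….XAc.map_charIdeal_le_span_of_roadFF_unr_le` consumes (`hSh`). No `sorry`.

## Source, verbatim

C. Skinner, E. Urban, *The Iwasawa Main Conjectures for GL₂*, Invent. Math. 195 (2014), §1.1
(p. 1, l. 8): "Let `p` be an odd prime"; §3.1.1–3.1.2 (pp. 16–18): Shapiro's lemma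
`H^i(E, M) = H^i(F, Ind^{G_F}_{G_E} M)` and its compatibility with restriction to the places `w ∣ v`
((3.1.2.a), (3.1.2.b)); §3.2.1 (p. 21): `ε_F : G_F ↠ Γ_F ⊂ Λ_{F,A}^×`; §3.2.2 (p. 21 l. 44 – p. 22
l. 31): "Let `A` be a profinite `ℤ_p`-algebra and let `T` be a free `A`-module of finite rank
equipped with a continuous `A`-linear action of `G_ℚ`. We assume given a `G_p`-stable `A`-free
direct summand `T_p` of `T`. Shapiro's lemma provides the following. **Proposition 3.2.3.** Let
`F = ℚ` or `K` [`K` an imaginary quadratic field in which `p` splits, standing]. There is a canonical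
isomorphism of `Λ_{F,A}`-modules `Sel^Σ_{F_∞}(T) ≅ Sel^Σ_F(T ⊗_A Λ_{F,A}(ε_F⁻¹))`. The right-hand
side is defined by viewing `T ⊗_A Λ_{F,A}` as a `Λ_{F,A}[G_F]`-module. When `F = K` the same
isomorphism holds with `F_∞` replaced by `K_∞^±`, `Λ_{F,A}` by `Λ^±_{K,A}`, and `ε_F` by `ε_{K,±}`.
*Proof.* … `lim→_n Hom_ℤ(ℤ[Gal(F_n/F)], A^*) = … = Λ^*_{F,A}(ε_F⁻¹)` … Appealing to Shapiro's lemma,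
it follows that `H¹(F_∞, T ⊗_A A^*) = lim→_n H¹(F_n, T ⊗_A A^*) = lim→_n H¹(F, Hom_ℤ(ℤ[Gal(F_n/F)],
T ⊗_A A^*)) = … = H¹(F, T ⊗_A Λ^*_{F,A}(ε_F⁻¹))`. That this identifies `Sel^Σ_{F_∞}(T)` with
`Sel^Σ_F(T ⊗_A Λ_{F,A}(ε_F⁻¹))` then follows from the analysis in 3.1.2. The same arguments apply to
the situation where `F = K` and `F_∞ = K_∞^±`. □ **Remark 3.2.4.** This recovers [Gr94, Prop. 3.2]."
F. Castella, Camb. J. Math. 6 (2018) §2.1, Def. 2.1–2.2 (p. 4): the anticyclotomic local conditions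
(`0` at `𝔭`, everything at `𝔭̄`, `H¹_ur` resp. — Def. 2.2 — `0` at `w ∤ p`, dropped at `w ∈ Σ`),
"`𝒜 := T ⊗_{ℤ_p} Λ^*` … `ρ_{E,p} ⊗ Ψ⁻¹`", "`X^Σ_ac(E[p^∞]) := Hom_{ℤ_p}(Sel^Σ_𝔭(K_∞, E[p^∞]), ℚ_p/ℤ_p)`".

## Transcription (dictionary and orientation check)

* `T = T_pE`, `A = ℤ_p`, `T ⊗_A A^* = E[p^∞]` = `PrimaryTorsion (geomPoints (W.baseChange K)) p`
  with `ρ_{E,p}` = `(W.baseChange K).primaryTorsionGaloisRep p`; `F = K`, `F_∞ = K_∞^-` = the top of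
  an ANTICYCLOTOMIC `ℤ_p`-extension `κ` (`ZpExtension.IsAnticyclotomic`), `Γ = ℤ_p` via `κ`, `γ` with
  `κ γ = 1` (`Fact (κ.IsTopGenerator γ)`), `Λ = ℤ_p⟦T⟧ = IwasawaAlgebra p`, `1 + T ↦ γ`.
* LEFT side `Sel^Σ_{K_∞}(T)^∨` with the BDP/Greenberg conditions of Cas18 Def. 2.2 = the tree's
  `Castella2018.AcSelmer.XAc (W.baseChange K) p κ 𝔭 Σ γ` (`K_∞`-formulation: strict above `𝔭`, relaxed
  above the other prime over `p`, locally trivial above the finite `w ∉ Σ`, `w ∤ p`; `Λ` acting by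
  `T = conj_γ − 1`, `(conj_σ c)(h) = σ • c(σ⁻¹ h σ)` — the tree's `conjH1`).
* RIGHT side `Sel^Σ_K(T ⊗ Λ(ε⁻¹))^∨` = `BigGaloisRep.XBigDecomp κ ρ_{E,p} 𝔭 Σ` (file
  `BigGaloisRepSelmer.lean`): the SAME local conditions prime by prime over `K` (decomposition-strict
  at `𝔭` and at every finite `w ∉ Σ`, `w ∤ p` — `strictSetDecomp p 𝔭 Σ`, Cas18 Def. 2.2 literally),
  on the co-induced model `M = C^∞(ℤ_p, E[p^∞])`, `(g·Φ)(x) = ρ(g)Φ(x − κ g)` (= `T ⊗ Λ^*(ε⁻¹)`: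
  `g` multiplies the `Λ^*`-factor by `ε(g)⁻¹ = [γ^{−κ g}]`), `(1 + T)·Φ = Φ(· + 1)`; dual = Mathlib
  `CharacterModule` (`(r·y)(s) = y(r·s)`).
* ORIENTATION (why no involution `ι` intervenes): Shapiro's map is `Sh[c](h) = c(h)(0)`; for
  `κ γ̃ = 1` the cocycle `g ↦ γ̃·c(γ̃⁻¹ g γ̃)` is cohomologous to `c`, and evaluating it gives
  `Sh[c] = conj_γ̃ (Sh[τ_{−1} c])`, i.e. `Sh[(1+T)·c] = conj_γ̃ (Sh[c])`: `1 + T` on the right matches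
  `conj_γ` on the left, so `x ↦ x ∘ Sh` is `Λ`-linear for the two `T`-actions above.
* Infinite places: `K` is imaginary quadratic, so the tree's condition at infinite places in
  `AcSelmer.selmerOver` is vacuous; `Σ` is a finite set of primes `w ∤ p` (Cas18).
Nothing else of [SU14] is used (no ordinarity: the local conditions above `p` here are the free
direct summands `T_𝔭⁺ = 0`, `T_𝔭̄⁺ = T`).

References: [SkinnerUrban2014] §3.1.1–3.1.2, §3.2.1–3.2.2, Prop. 3.2.3, Rem. 3.2.4; [Castella2018]
§2.1, Def. 2.1–2.2 (p. 4); [Greenberg1994Motives] Prop. 3.2 (as cited by SU14, not used).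
-/

noncomputable section

open Field IsDedekindDomain NumberField WeierstrassCurve
open Literature.NumberTheory.EllipticCurves Literature.NumberTheory.EllipticCurves.BigGaloisRep
open Literature.NumberTheory.GaloisRepresentations

namespace Literature.NumberTheory.EllipticCurves.SkinnerUrban2014

/-- **Skinner–Urban 2014, Prop. 3.2.3 (Shapiro's lemma for Selmer groups), anticyclotomic case
`F = K`, `F_∞ = K_∞^-`, `T = T_pE`, `A = ℤ_p`, with the `Σ`-imprimitive anticyclotomic local
conditions of Castella 2018, Def. 2.2, DUALISED:** for `E/ℚ` an elliptic curve, `p` an odd prime,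
`K` an imaginary quadratic field in which `p` splits, `𝔭 ∣ p` the strict prime, `Σ` a finite set of
primes of `K` not dividing `p`, `κ` the anticyclotomic `ℤ_p`-extension with topological generator
`γ` (`1 + T ↦ γ`), the Pontryagin duals of `Sel^Σ_𝔭(K_∞, E[p^∞])` (the tree's `AcSelmer.XAc`) and of
`Sel^Σ_𝔭(K, T_pE ⊗ Λ^*(Ψ⁻¹))` (the tree's `BigGaloisRep.XBigDecomp` of the co-induced model
`(W.baseChange K).primaryTorsionGaloisRep p`) are isomorphic `Λ = ℤ_p⟦T⟧`-modules ("canonical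
isomorphism of `Λ_{F,A}`-modules `Sel^Σ_{F_∞}(T) ≅ Sel^Σ_F(T ⊗_A Λ_{F,A}(ε_F⁻¹))`"). Stated for every
topology on `Λ` making the action on the discrete module continuous (the groups do not depend on it).
[cite: SkinnerUrban2014, Prop. 3.2.3 with §3.1.2 ((3.1.2.a)–(3.1.2.b)) and §3.2.1–3.2.2 (pp. 16–18, 21–22)]
[cite: Castella2018, Def. 2.2 and §2.1 (p. 4, "`𝒜 := T ⊗_{ℤ_p} Λ^*`", "`X^Σ_ac(E[p^∞])`")] -/
def prop323_XAc_equiv_XBigDecomp : Prop :=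
  ∀ (W : WeierstrassCurve ℚ) [W.IsElliptic] (p : ℕ) [Fact p.Prime], 3 ≤ p →
    ∀ (K : Type) [Field K] [NumberField K], IsImaginaryQuadratic K →
      SatisfiesHeegnerHypothesis p K →
    ∀ (𝔭 : HeightOneSpectrum (𝓞 K)), ((p : ℕ) : 𝓞 K) ∈ 𝔭.asIdeal →
    ∀ (S : Set (HeightOneSpectrum (𝓞 K))), S.Finite → (∀ w ∈ S, ((p : ℕ) : 𝓞 K) ∉ w.asIdeal) →
    ∀ (κ : ZpExtension K p), κ.IsAnticyclotomic →
    ∀ (γ : absoluteGaloisGroup K) [Fact (κ.IsTopGenerator γ)]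
      [TopologicalSpace (IwasawaAlgebra p)]
      [ContinuousSMul (IwasawaAlgebra p)
        (BigRepModule ℤ_[p] p (PrimaryTorsion (geomPoints (W.baseChange K)) p))],
      Nonempty
        (Castella2018.AcSelmer.XAc (W.baseChange K) p κ 𝔭 S γ ≃ₗ[IwasawaAlgebra p]
          XBigDecomp κ ((W.baseChange K).primaryTorsionGaloisRep p) 𝔭 S)

/-! ### Proved corollaries: the shapes consumed downstream -/

section Corollaries

variable (W : WeierstrassCurve ℚ) [W.IsElliptic] (p : ℕ) [Fact p.Prime] (hp : 3 ≤ p)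
  (K : Type) [Field K] [NumberField K] (hK : IsImaginaryQuadratic K)
  (hsplit : SatisfiesHeegnerHypothesis p K)
  (𝔭 : HeightOneSpectrum (𝓞 K)) (h𝔭 : ((p : ℕ) : 𝓞 K) ∈ 𝔭.asIdeal)
  (S : Set (HeightOneSpectrum (𝓞 K))) (hS : S.Finite) (hSp : ∀ w ∈ S, ((p : ℕ) : 𝓞 K) ∉ w.asIdeal)
  (κ : ZpExtension K p) (hκ : κ.IsAnticyclotomic)
  (γ : absoluteGaloisGroup K) [Fact (κ.IsTopGenerator γ)]
  [TopologicalSpace (IwasawaAlgebra p)]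
  [ContinuousSMul (IwasawaAlgebra p)
    (BigRepModule ℤ_[p] p (PrimaryTorsion (geomPoints (W.baseChange K)) p))]

include hp hK hsplit h𝔭 hS hSp hκ

/-- **`Ch_Λ(X^Σ_ac(E[p^∞])) = Ch_Λ(Sel^Σ_𝔭(K, T_pE ⊗ Λ^*)^∨)`** — characteristic ideals agree along
the Shapiro isomorphism (`Module.charIdeal_eq_of_linearEquiv`).
[cite: SkinnerUrban2014, Prop. 3.2.3 (isomorphism of Λ-modules)] -/
theorem charIdeal_XAc_eq_charIdeal_XBigDecomp (h : prop323_XAc_equiv_XBigDecomp) :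
    Castella2018.AcSelmer.XAc.charIdeal (W.baseChange K) p κ 𝔭 S γ =
      Module.charIdeal (IwasawaAlgebra p)
        (XBigDecomp κ ((W.baseChange K).primaryTorsionGaloisRep p) 𝔭 S) := by
  obtain ⟨e⟩ := h W p hp K hK hsplit 𝔭 h𝔭 S hS hSp κ hκ γ
  exact Module.charIdeal_eq_of_linearEquiv e

/-- The inequality shape `hSh` of the kernel's Road-FF glue (`Ch_Λ(X^Σ_ac) ≤ Ch_Λ(X_K^Σ)`, here
with equality) for `L₀ = strictSetDecomp p 𝔭 Σ`, `ψ = localMap K`, `ρf = anticyclotomicBigRep`.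
[cite: SkinnerUrban2014, Prop. 3.2.3] -/
theorem charIdeal_XAc_le_charIdeal_selmerDecomp (h : prop323_XAc_equiv_XBigDecomp) :
    Castella2018.AcSelmer.XAc.charIdeal (W.baseChange K) p κ 𝔭 S γ ≤
      Module.charIdeal (IwasawaAlgebra p)
        (CharacterModule
          (selmer (localMap K) (strictSetDecomp p 𝔭 S)
            ((W.baseChange K).anticyclotomicBigRep p κ))) :=
  (charIdeal_XAc_eq_charIdeal_XBigDecomp W p hp K hK hsplit 𝔭 h𝔭 S hS hSp κ hκ γ h).le

/-- `X^Σ_ac(E[p^∞])` is `Λ`-torsion iff `Sel^Σ_𝔭(K, T_pE ⊗ Λ^*)^∨` is (transport along the Shapiro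
isomorphism). [cite: SkinnerUrban2014, Prop. 3.2.3 (isomorphism of Λ-modules)] -/
theorem isTorsion_XAc_iff_isTorsion_XBigDecomp (h : prop323_XAc_equiv_XBigDecomp) :
    Module.IsTorsion (IwasawaAlgebra p) (Castella2018.AcSelmer.XAc (W.baseChange K) p κ 𝔭 S γ) ↔
      Module.IsTorsion (IwasawaAlgebra p)
        (XBigDecomp κ ((W.baseChange K).primaryTorsionGaloisRep p) 𝔭 S) := by
  obtain ⟨e⟩ := h W p hp K hK hsplit 𝔭 h𝔭 S hS hSp κ hκ γ
  constructor
  · intro hT y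
    obtain ⟨r, hr⟩ := @hT (e.symm y)
    refine ⟨r, ?_⟩
    rw [Submonoid.smul_def] at hr ⊢
    have := congrArg e hr
    rwa [LinearEquiv.map_smul, LinearEquiv.apply_symm_apply, LinearEquiv.map_zero] at this
  · intro hT x
    obtain ⟨r, hr⟩ := @hT (e x)
    refine ⟨r, ?_⟩
    rw [Submonoid.smul_def] at hr ⊢
    have := congrArg e.symm hr
    rwa [LinearEquiv.map_smul, LinearEquiv.symm_apply_apply, LinearEquiv.map_zero] at this

/-- `X^Σ_ac(E[p^∞])` is a finitely generated `Λ`-module iff `Sel^Σ_𝔭(K, T_pE ⊗ Λ^*)^∨` is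
(`Module.Finite.equiv`). [cite: SkinnerUrban2014, Prop. 3.2.3 (isomorphism of Λ-modules)] -/
theorem finite_XAc_iff_finite_XBigDecomp (h : prop323_XAc_equiv_XBigDecomp) :
    Module.Finite (IwasawaAlgebra p) (Castella2018.AcSelmer.XAc (W.baseChange K) p κ 𝔭 S γ) ↔
      Module.Finite (IwasawaAlgebra p)
        (XBigDecomp κ ((W.baseChange K).primaryTorsionGaloisRep p) 𝔭 S) := by
  obtain ⟨e⟩ := h W p hp K hK hsplit 𝔭 h𝔭 S hS hSp κ hκ γ
  exact ⟨fun _ => Module.Finite.equiv e, fun _ => Module.Finite.equiv e.symm⟩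

end Corollaries

end Literature.NumberTheory.EllipticCurves.SkinnerUrban2014

end
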